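import Summits.QuantumAdvantage.QuantumAdvantage.Theorems.CubicForrelationNearExactIsExactTwelveLevelFiveOffFlatAll

/-!
# Crux `CubicForrelation.NearExactIsExact` (stmt-QuantumAdvantage-14043) — n = 12, level 5 AT the boundary `Φ ≥ 59/64`:
  off the odd hyperplane the pair is exact (closed version of `tw5_off_flat_all`)

Certificate seat `b2b-cforr-cert` (gen 15).  HONEST FRAMING: a lemma (standard axioms) about cubic Boolean pairs on 12 bits, feeding the
theorem "a level-5 side is impossible for `Φ ≥ 59/64`" (`…TwelveLevelFiveGe5964.lean`), itself one branch of "is `59/64` attained at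
`n = 12`?" (tree: `θ₁₂ ∈ [57/64, 59/64]`, `theta_twelve_closed_5964`).  Finite-slice bookkeeping; NOT summit progress.

Setting: cubic `f, g : 𝔽₂¹² → 𝔽₂`, `W_g = 32·u'` with some `u'(x)` odd (level 5), `P = {u' odd}` (an affine hyperplane, `2¹¹` points),
residual `e = u' − 2(−1)^f`, budget `Σ e² = 2¹⁵(1 − Φ) ≤ 2560` at `Φ ≥ 59/64`, of which `#P = 2048` is spent on `P` (`e` odd there).
* `tw15_annP2`: `64 ∣ Σ_{ℓ = 0, x_j = 0} u'` for affine `ℓ` (inclusion–exclusion of three annihilator sums `tw5_annP ∈ 128ℤ`).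
* `tw15_off_flat_le`: `e = 0` off `P`.  By `tw5_off_flat_16`, `16 ∣ e` off `P`; the off-`P` energy `≤ 512` allows at most TWO non-zero
  points `e = ±16`.  One point contradicts `Σ_{P^c} e ∈ 128ℤ + 32ℤ` (`tw5_annP`, Ax `tw5_axP`) as in `tw5_off_flat_all`; two points
  `y₀ ≠ y₁` are separated by a coordinate `j`, and the trace `P^c ∩ {x_j = 0}` contains exactly one of them, while
  `Σ_{P^c, x_j = 0} e = Σ u' − 2Σ(−1)^f ∈ 64ℤ + 32ℤ` (`tw15_annP2`, `tw5_axP`) — again `±16 ∉ 32ℤ`.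
(The tree's `tw5_off_flat_all` needed `Φ > 59/64`, i.e. off-`P` energy `< 512`, and stopped at one point.)

References: J. Ax (1964) / R. J. McEliece (1972); MacWilliams–Sloane (1977) Ch. 13 §3; R. O'Donnell (2014) §3.3.  Everything below is
proved from Mathlib and the tree; axioms are the standard three.
-/

set_option linter.dupNamespace false -- D-0017: single-problem summit ⇒ `QuantumAdvantage.QuantumAdvantage` by design

noncomputable section

namespace Summit.QuantumAdvantage.QuantumAdvantage.Theorems.CubicForrelation.NearExactIsExact

open Finset
open Literature.Computability.QuantumComplexity
open Literature.Computability.QuantumComplexity.BuzetChailloux (bxor zeroVec bxor_bxor_cancel_left bxor_zeroVec zeroVec_bxor bxor_comm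
  bxor_self)
open Literature.Computability.QuantumComplexity.DerivativeWalsh (W)

/-! ### Annihilator sums of `u'` over the trace of a hyperplane on a coordinate hyperplane -/

/-- **`64 ∣ Σ_{ℓ = 0, x_j = 0} u'`** for `u' = W_g/32` and affine `ℓ`: inclusion–exclusion
`2·1_{ℓ=0, x_j=0} = 1_{ℓ=0} + 1_{x_j=0} − 1_{ℓ ⊕ x_j = 1}` of three annihilator sums, each in `128ℤ` by `tw5_annP`. [this work] -/
theorem tw15_annP2 (g : (Fin (6 + 6) → Bool) → Bool) (u' : (Fin (6 + 6) → Bool) → ℤ)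
    (hu' : ∀ x, W (fun y => signOf (g y)) x = (2 : ℝ) ^ 5 * (u' x : ℝ)) (ℓ : (Fin (6 + 6) → Bool) → Bool) (hℓ : IsDegLeFun 1 ℓ)
    (j : Fin (6 + 6)) :
    (64 : ℤ) ∣ ∑ x ∈ univ.filter (fun x : Fin (6 + 6) → Bool => ℓ x = false ∧ x j = false), u' x := by
  classical
  have hj : IsDegLeFun 1 (fun x : Fin (6 + 6) → Bool => x j) := isDegLeFun_apply j le_rfl
  have h1 := tw5_annP g u' hu' ℓ hℓ
  have h2 : (128 : ℤ) ∣ ∑ x ∈ univ.filter (fun x : Fin (6 + 6) → Bool => x j = false), u' x := tw5_annP g u' hu' _ hj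
  have h3 : (128 : ℤ) ∣ ∑ x ∈ univ.filter (fun x : Fin (6 + 6) → Bool => ((ℓ x ^^ x j) ^^ true) = false), u' x :=
    tw5_annP g u' hu' _ (tb_isDegLeFun_xor_const (bb_isDegLeFun_bxor hℓ hj) true)
  have key : 2 * ∑ x ∈ univ.filter (fun x : Fin (6 + 6) → Bool => ℓ x = false ∧ x j = false), u' x =
      ∑ x ∈ univ.filter (fun x : Fin (6 + 6) → Bool => ℓ x = false), u' x +
      ∑ x ∈ univ.filter (fun x : Fin (6 + 6) → Bool => x j = false), u' x -
      ∑ x ∈ univ.filter (fun x : Fin (6 + 6) → Bool => ((ℓ x ^^ x j) ^^ true) = false), u' x := by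
    rw [mul_sum, sum_filter, sum_filter, sum_filter, sum_filter, ← sum_add_distrib, ← sum_sub_distrib]
    refine sum_congr rfl fun x _ => ?_
    cases ℓ x <;> cases x j <;> simp [two_mul]
  obtain ⟨a, ha⟩ := h1
  obtain ⟨b, hb⟩ := h2
  obtain ⟨c, hc⟩ := h3
  rw [ha, hb, hc] at key
  exact ⟨a + b - c, by linarith⟩

/-! ### Level 5 at `Φ ≥ 59/64`: off the hyperplane the pair is exact -/

/-- **Level 5 with `Φ ≥ 59/64`: off the hyperplane the pair is exact.**  Cubic `f, g : 𝔽₂¹² → 𝔽₂`, `W_g = 32·u'` with some `u'(x)`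
odd, `Φ(f,g) ≥ 59/64`.  Then `u' = 2(−1)^f` wherever `u'` is even.  (`16 ∣ e` off `P` by `tw5_off_flat_16`; at most two non-zero
off-`P` points `e = ±16`; one point contradicts `Σ_{P^c} e ∈ 32ℤ`, two points are separated by a coordinate and the trace
`Σ_{P^c ∩ {x_j = 0}} e ∈ 32ℤ` (`tw15_annP2`, `tw5_axP`) sees exactly one of them.)  Closed version of `tw5_off_flat_all`; finite-slice
statement, NOT summit progress. [this work] -/
theorem tw15_off_flat_le (f g : (Fin (6 + 6) → Bool) → Bool) (hf : IsDegLeFun 3 f) (hg : IsDegLeFun 3 g)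
    (u' : (Fin (6 + 6) → Bool) → ℤ) (hu' : ∀ x, W (fun y => signOf (g y)) x = (2 : ℝ) ^ 5 * (u' x : ℝ))
    (hodd : ∃ x, Odd (u' x)) (hΦ : (59 / 64 : ℝ) ≤ forrelation f g) :
    ∀ y, ¬ Odd (u' y) → u' y = 2 * sZ (f y) := by
  classical
  -- `u = 2u'` at the Ax level `4`; residual `e = u' − 2s`, budget `B = Σ e² = 2¹⁵(1 − Φ) ≤ 2560`
  set u : (Fin (6 + 6) → Bool) → ℤ := fun x => 2 * u' x with hudef
  have hu : ∀ x, W (fun y => signOf (g y)) x = (2 : ℝ) ^ 4 * (u x : ℝ) := by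
    intro x; rw [hu' x]; simp only [u]; push_cast; ring
  set e : (Fin (6 + 6) → Bool) → ℤ := fun x => u' x - 2 * sZ (f x) with hedef
  have hbud := tw12_budget f g u hu
  have h4e : ∀ x, (u x - 4 * sZ (f x)) ^ 2 = 4 * e x ^ 2 := fun x => by simp only [u, e]; ring
  have hBR : ((∑ x, e x ^ 2 : ℤ) : ℝ) = 32768 * (1 - forrelation f g) := by
    have h' : ((∑ x, (u x - 4 * sZ (f x)) ^ 2 : ℤ) : ℝ) = 4 * ((∑ x, e x ^ 2 : ℤ) : ℝ) := by
      rw [sum_congr rfl fun x _ => h4e x, ← mul_sum]; push_cast; ring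
    rw [h'] at hbud
    linarith
  have hB_le : (∑ x, e x ^ 2 : ℤ) ≤ 2560 := by
    have h' : ((∑ x, e x ^ 2 : ℤ) : ℝ) ≤ 2560 := by rw [hBR]; linarith
    exact_mod_cast h'
  -- the odd set `P` of `u'` is an affine hyperplane
  have hℓ : IsDegLeFun 1 (fun x => decide (Odd (u' x))) :=
    stub_walshTower stub_axParity (6 + 6) 5 1 g u' hg hu' (by intro k hk hkn; omega)
  set P := univ.filter (fun x : Fin (6 + 6) → Bool => Odd (u' x)) with hPdef
  have hmemP : ∀ x, x ∈ P ↔ Odd (u' x) := fun x => by simp [hPdef]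
  have heodd : ∀ x, x ∈ P → Odd (e x) := by
    intro x hx
    exact Int.odd_sub.2 (iff_of_true ((hmemP x).1 hx) ⟨sZ (f x), two_mul _⟩)
  have hsq1 : ∀ x, x ∈ P → 1 ≤ e x ^ 2 := by
    intro x hx
    have h0 := Int.odd_iff.1 (heodd x hx)
    have : e x ≤ -1 ∨ 1 ≤ e x := by omega
    have := tp_sq_ge (k := 1) (by norm_num) this
    linarith
  have hsplit : (∑ x, e x ^ 2 : ℤ) = ∑ x ∈ P, e x ^ 2 + ∑ x ∈ univ.filter (fun x => x ∉ P), e x ^ 2 := by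
    rw [← sum_filter_add_sum_filter_not univ (fun x => x ∈ P)]
    congr 1
    exact sum_congr (by ext x; simp) fun _ _ => rfl
  have hoff_nn : 0 ≤ ∑ x ∈ univ.filter (fun x => x ∉ P), e x ^ 2 := sum_nonneg fun x _ => sq_nonneg _
  have hPle : (#P : ℤ) ≤ 2560 := by
    have h1 : (#P : ℤ) = ∑ x ∈ P, (1 : ℤ) := by rw [sum_const, nsmul_eq_mul, mul_one]
    have h2 : ∑ x ∈ P, (1 : ℤ) ≤ ∑ x ∈ P, e x ^ 2 := sum_le_sum fun x hx => hsq1 x hx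
    linarith
  have hfilt : (univ.filter fun x : Fin (6 + 6) → Bool => decide (Odd (u' x)) = true) = P := filter_congr fun x _ => by simp
  have hPge : 2048 ≤ #P := by
    obtain ⟨x₁, hx₁⟩ := hodd
    have hRM := bb_rmWeight_holds (6 + 6) 1 (fun x => decide (Odd (u' x))) hℓ ⟨x₁, decide_eq_true hx₁⟩
    rw [hfilt] at hRM
    norm_num at hRM
    omega
  have hPc : 2048 ≤ #(univ.filter fun x : Fin (6 + 6) → Bool => x ∉ P) := by
    have hPlt : #P < 4096 := by
      have hlt' : (#P : ℤ) < 4096 := by linarith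
      exact_mod_cast hlt'
    have hne : ∃ x, x ∉ P := by
      by_contra hall
      push Not at hall
      have : #P = 4096 := by
        rw [show P = univ from eq_univ_of_forall hall, card_univ, Fintype.card_fun, Fintype.card_bool, Fintype.card_fin]; norm_num
      omega
    obtain ⟨x₂, hx₂⟩ := hne
    have hℓ' : IsDegLeFun 1 (fun x => decide (Odd (u' x)) ^^ true) := tb_isDegLeFun_xor_const hℓ true
    have hRM := bb_rmWeight_holds (6 + 6) 1 (fun x => decide (Odd (u' x)) ^^ true) hℓ'
      ⟨x₂, by have := (hmemP x₂).not.1 hx₂; simpa using this⟩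
    have hfilt' : (univ.filter fun x : Fin (6 + 6) → Bool => (decide (Odd (u' x)) ^^ true) = true) =
        univ.filter fun x : Fin (6 + 6) → Bool => x ∉ P := filter_congr fun x _ => by rw [hmemP]; simp
    rw [hfilt'] at hRM
    norm_num at hRM ⊢
    omega
  have hcardP : #P = 2048 := by
    have htot : #P + #(univ.filter fun x : Fin (6 + 6) → Bool => x ∉ P) = 4096 := by
      have h := Finset.card_filter_add_card_filter_not (s := (univ : Finset (Fin (6 + 6) → Bool))) (fun x => x ∈ P)
      rw [card_univ, Fintype.card_fun, Fintype.card_bool, Fintype.card_fin] at h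
      have e1 : (univ.filter fun x : Fin (6 + 6) → Bool => x ∈ P) = P := by ext x; simp
      rw [e1] at h
      norm_num at h
      exact h
    omega
  -- `P` is a coset of an xor-closed `V` with `2¹¹` elements
  have hmw := mw_flat_of_minweight 0 (fun x => decide (Odd (u' x))) hℓ (by rw [hfilt, hcardP]; norm_num)
  rw [hfilt] at hmw
  obtain ⟨h0, hadd, hcardV, hcoset⟩ := hmw
  set V := univ.filter (fun a : Fin (6 + 6) → Bool => ∀ x, decide (Odd (u' (bxor x a))) = decide (Odd (u' x))) with hV
  obtain ⟨xP, hxP⟩ : P.Nonempty := card_pos.1 (by rw [hcardP]; norm_num)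
  have hS : P = V.image (bxor xP) := hcoset xP (decide_eq_true ((hmemP xP).1 hxP))
  rw [hcardP] at hcardV
  have hcardV11 : #V = 2 ^ 11 := by rw [hcardV]; norm_num
  -- off `P`: `16 ∣ e`, and at most two non-zero points
  have hPsum_ge : (2048 : ℤ) ≤ ∑ x ∈ P, e x ^ 2 := by
    have h1 : ∑ x ∈ P, (1 : ℤ) ≤ ∑ x ∈ P, e x ^ 2 := sum_le_sum fun x hx => hsq1 x hx
    rw [sum_const, nsmul_eq_mul, mul_one, hcardP] at h1
    exact_mod_cast h1
  have hoff_le : ∑ x ∈ univ.filter (fun x => x ∉ P), e x ^ 2 ≤ 512 := by linarith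
  have hoff16 : ∀ y, y ∉ P → (16 : ℤ) ∣ e y :=
    tw5_off_flat_16 f g hf hg u' hu' V xP h0 hadd hcardV11 hS (by linarith)
  have hsq256 : ∀ y, y ∉ P → e y ≠ 0 → 256 ≤ e y ^ 2 := by
    intro y hy hy0
    obtain ⟨k, hk⟩ := hoff16 y hy
    have hk0 : k ≠ 0 := by rintro rfl; exact hy0 (by rw [hk]; ring)
    have : k ≤ -1 ∨ 1 ≤ k := by omega
    have := tp_sq_ge (k := 1) (by norm_num) this
    rw [hk]; nlinarith
  -- a non-zero off-`P` value is `±16` as soon as another `256` of the off-`P` energy is accounted for elsewhere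
  have hpm16 : ∀ y, y ∉ P → e y ≠ 0 → e y ^ 2 ≤ 511 → e y = 16 ∨ e y = -16 := by
    intro y hy hy0 hle
    obtain ⟨k, hk⟩ := hoff16 y hy
    rw [hk] at hle ⊢
    have hk1 : k ≤ 1 := by nlinarith
    have hk2 : -1 ≤ k := by nlinarith
    have hk0 : k ≠ 0 := by rintro rfl; exact hy0 (by rw [hk]; ring)
    omega
  -- `Σ_{P^c} u' ∈ 128ℤ`, `Σ_{P^c} (−1)^f ∈ 16ℤ`; traces on a coordinate hyperplane: `64ℤ`, `16ℤ`
  have h128 := tw5_annP g u' hu' (fun x => decide (Odd (u' x))) hℓ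
  have hfiltF : (univ.filter fun x : Fin (6 + 6) → Bool => decide (Odd (u' x)) = false) =
      univ.filter fun x : Fin (6 + 6) → Bool => x ∉ P := filter_congr fun x _ => by rw [hmemP]; simp
  rw [hfiltF] at h128
  have hℓ' : IsDegLeFun 1 (fun x => decide (Odd (u' x)) ^^ true) := tb_isDegLeFun_xor_const hℓ true
  have h16 := (tw5_axP (fun x => decide (Odd (u' x)) ^^ true) f hℓ' hf 0).1
  have hfiltT : (univ.filter fun x : Fin (6 + 6) → Bool => (decide (Odd (u' x)) ^^ true) = true) =
      univ.filter fun x : Fin (6 + 6) → Bool => x ∉ P := filter_congr fun x _ => by rw [hmemP]; simp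
  rw [hfiltT] at h16
  have h64j : ∀ j : Fin (6 + 6), (64 : ℤ) ∣ ∑ x ∈ univ.filter (fun x : Fin (6 + 6) → Bool => x ∉ P ∧ x j = false), u' x := by
    intro j
    have h := tw15_annP2 g u' hu' (fun x => decide (Odd (u' x))) hℓ j
    have hfj : (univ.filter fun x : Fin (6 + 6) → Bool => decide (Odd (u' x)) = false ∧ x j = false) =
        univ.filter fun x : Fin (6 + 6) → Bool => x ∉ P ∧ x j = false := filter_congr fun x _ => by rw [hmemP]; simp
    rwa [hfj] at h
  have h16j : ∀ j : Fin (6 + 6), (16 : ℤ) ∣ ∑ x ∈ univ.filter (fun x : Fin (6 + 6) → Bool => x ∉ P ∧ x j = false), sZ (f x) := by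
    intro j
    have h := (tw5_axP (fun x => decide (Odd (u' x)) ^^ true) f hℓ' hf j).2
    have hfj : (univ.filter fun x : Fin (6 + 6) → Bool => (decide (Odd (u' x)) ^^ true) = true ∧ x j = false) =
        univ.filter fun x : Fin (6 + 6) → Bool => x ∉ P ∧ x j = false := filter_congr fun x _ => by rw [hmemP]; simp
    rwa [hfj] at h
  -- the separation argument: a lone `±16` in `P^c ∩ {x_j = 0}` contradicts `Σ e ∈ 32ℤ` there
  have hsep : ∀ (j : Fin (6 + 6)) (z : Fin (6 + 6) → Bool), z ∉ P → z j = false → (e z = 16 ∨ e z = -16) →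
      (∀ y, y ∉ P → y j = false → y ≠ z → e y = 0) → False := by
    intro j z hz hzj hez hzero
    have hsum : ∑ x ∈ univ.filter (fun x : Fin (6 + 6) → Bool => x ∉ P ∧ x j = false), e x = e z :=
      sum_eq_single_of_mem z (mem_filter.2 ⟨mem_univ _, hz, hzj⟩) fun x hx hxz =>
        hzero x (mem_filter.1 hx).2.1 (mem_filter.1 hx).2.2 hxz
    have hdec : ∑ x ∈ univ.filter (fun x : Fin (6 + 6) → Bool => x ∉ P ∧ x j = false), e x =
        ∑ x ∈ univ.filter (fun x : Fin (6 + 6) → Bool => x ∉ P ∧ x j = false), u' x -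
        2 * ∑ x ∈ univ.filter (fun x : Fin (6 + 6) → Bool => x ∉ P ∧ x j = false), sZ (f x) := by
      rw [mul_sum, ← sum_sub_distrib]
    obtain ⟨m, hm⟩ := h64j j
    obtain ⟨w, hw⟩ := h16j j
    rw [hsum, hm, hw] at hdec
    rcases hez with h | h <;> rw [h] at hdec <;> omega
  intro y₀ hy₀'
  have hy₀ : y₀ ∉ P := fun h => hy₀' ((hmemP y₀).1 h)
  by_contra hne
  have hne' : e y₀ ≠ 0 := by intro h0'; apply hne; have : e y₀ = 0 := h0'; simp only [e] at this; linarith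
  have hmem₀ : y₀ ∈ univ.filter (fun x : Fin (6 + 6) → Bool => x ∉ P) := mem_filter.2 ⟨mem_univ _, hy₀⟩
  by_cases hex : ∃ y₁, y₁ ∉ P ∧ y₁ ≠ y₀ ∧ e y₁ ≠ 0
  · -- two non-zero points off `P`: both `±16`, everything else zero
    obtain ⟨y₁, hy₁, hy₁₀, hne₁⟩ := hex
    have hmem₁ : y₁ ∈ univ.filter (fun x : Fin (6 + 6) → Bool => x ∉ P) := mem_filter.2 ⟨mem_univ _, hy₁⟩
    have hpair : e y₀ ^ 2 + e y₁ ^ 2 ≤ ∑ x ∈ univ.filter (fun x => x ∉ P), e x ^ 2 := by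
      have hsub : ({y₀, y₁} : Finset (Fin (6 + 6) → Bool)) ⊆ univ.filter (fun x => x ∉ P) := by
        intro z hz
        rcases mem_insert.1 hz with rfl | hz
        · exact hmem₀
        · rw [mem_singleton.1 hz]; exact hmem₁
      have := sum_le_sum_of_subset_of_nonneg hsub (fun x _ _ => sq_nonneg (e x))
      rwa [sum_pair (Ne.symm hy₁₀)] at this
    have h256₀ := hsq256 y₀ hy₀ hne'
    have h256₁ := hsq256 y₁ hy₁ hne₁
    have hothers : ∀ y, y ∉ P → y ≠ y₀ → y ≠ y₁ → e y = 0 := by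
      intro y hy hyy₀ hyy₁
      by_contra hy0
      have h3 : e y₀ ^ 2 + e y₁ ^ 2 + e y ^ 2 ≤ ∑ x ∈ univ.filter (fun x => x ∉ P), e x ^ 2 := by
        have hsub : ({y₀, y₁, y} : Finset (Fin (6 + 6) → Bool)) ⊆ univ.filter (fun x => x ∉ P) := by
          intro z hz
          rcases mem_insert.1 hz with rfl | hz
          · exact hmem₀
          rcases mem_insert.1 hz with rfl | hz
          · exact hmem₁
          · rw [mem_singleton.1 hz]; exact mem_filter.2 ⟨mem_univ _, hy⟩
        have := sum_le_sum_of_subset_of_nonneg hsub (fun x _ _ => sq_nonneg (e x))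
        have hy₀not : y₀ ∉ ({y₁, y} : Finset (Fin (6 + 6) → Bool)) := by
          rw [mem_insert, mem_singleton, not_or]; exact ⟨Ne.symm hy₁₀, Ne.symm hyy₀⟩
        have hy₁not : y₁ ∉ ({y} : Finset (Fin (6 + 6) → Bool)) := by rw [mem_singleton]; exact Ne.symm hyy₁
        rw [sum_insert hy₀not, sum_insert hy₁not, sum_singleton] at this
        linarith
      have := hsq256 y hy hy0
      linarith
    have he₀ := hpm16 y₀ hy₀ hne' (by linarith)
    have he₁ := hpm16 y₁ hy₁ hne₁ (by linarith)
    -- a separating coordinate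
    obtain ⟨j, hj⟩ : ∃ j, y₀ j ≠ y₁ j := by
      by_contra hall
      push Not at hall
      exact hy₁₀ (funext fun j => (hall j).symm)
    cases hy₀j : y₀ j
    · -- `y₀` in the trace, `y₁` outside
      have hy₁j : y₁ j = true := by
        cases h : y₁ j
        · exact absurd (hy₀j.trans h.symm) hj
        · rfl
      exact hsep j y₀ hy₀ hy₀j he₀ fun y hy hyj hyy₀ => by
        by_cases hyy₁ : y = y₁
        · rw [hyy₁] at hyj; rw [hy₁j] at hyj; exact absurd hyj (by decide)
        · exact hothers y hy hyy₀ hyy₁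
    · have hy₁j : y₁ j = false := by
        cases h : y₁ j
        · rfl
        · exact absurd (hy₀j.trans h.symm) hj
      exact hsep j y₁ hy₁ hy₁j he₁ fun y hy hyj hyy₁ => by
        by_cases hyy₀ : y = y₀
        · rw [hyy₀] at hyj; rw [hy₀j] at hyj; exact absurd hyj (by decide)
        · exact hothers y hy hyy₀ hyy₁
  · -- `y₀` is the only non-zero point off `P`: `Σ_{P^c} e = e(y₀) = ±16 ∉ 32ℤ`
    push Not at hex
    have hothers : ∀ y, y ∉ P → y ≠ y₀ → e y = 0 := fun y hy hyy => by
      by_contra h; exact h (hex y hy hyy)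
    have he16 : e y₀ = 16 ∨ e y₀ = -16 := by
      refine hpm16 y₀ hy₀ hne' ?_
      have h1 : ∑ x ∈ univ.filter (fun x => x ∉ P), e x ^ 2 = e y₀ ^ 2 :=
        sum_eq_single_of_mem y₀ hmem₀ fun x hx hxy => by rw [hothers x (mem_filter.1 hx).2 hxy]; ring
      -- `e(y₀)² ≤ 512` and `16 ∣ e(y₀)` force `e(y₀)² = 256`
      obtain ⟨k, hk⟩ := hoff16 y₀ hy₀
      have hle : e y₀ ^ 2 ≤ 512 := by linarith
      rw [hk] at hle ⊢
      have hk1 : k ≤ 1 := by nlinarith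
      have hk2 : -1 ≤ k := by nlinarith
      have : k * k ≤ 1 := by nlinarith
      nlinarith
    have hsumoff : ∑ x ∈ univ.filter (fun x => x ∉ P), e x = e y₀ :=
      sum_eq_single_of_mem y₀ hmem₀ fun x hx hxy => hothers x (mem_filter.1 hx).2 hxy
    have hdec : ∑ x ∈ univ.filter (fun x => x ∉ P), e x =
        ∑ x ∈ univ.filter (fun x => x ∉ P), u' x - 2 * ∑ x ∈ univ.filter (fun x => x ∉ P), sZ (f x) := by
      rw [mul_sum, ← sum_sub_distrib]
    obtain ⟨m, hm⟩ := h128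
    obtain ⟨z, hz⟩ := h16
    rw [hsumoff, hm, hz] at hdec
    rcases he16 with h | h <;> rw [h] at hdec <;> omega

end Summit.QuantumAdvantage.QuantumAdvantage.Theorems.CubicForrelation.NearExactIsExact

end
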